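import Literature.MathematicalPhysics.QuantumFieldTheory.Balaban1983to89.B8Eq348CubeMemberTowerGramCoercive
import Literature.MathematicalPhysics.QuantumFieldTheory.Balaban1983to89.B8Eq348CubeMemberFlatMatrixNorm
import Literature.MathematicalPhysics.QuantumFieldTheory.Balaban1983to89.B8Eq1101CubeMemberWeights

/-!
# `Balaban1983to89.B8Eq348CubeMemberTowerGramGap` — [Balaban1985BackgroundPropagators] (3.48): the UNCONDITIONAL `ℓ²` GAP of the tower Gram matrix `QT⁻²Qᵀ` of the
# cube member — `Σ_p L^{−(d+1)j_p}X_p² ≤ ((4(d+1) + a_max)η⁻²)²·⟨X, (QT⁻¹T⁻¹Qᵀ)X⟩` (F11 ∘ F12), and at the printed weights (`a_max = 8`)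

statement-level skeleton of published theorems with citation tags; proofs where landed; nothing here is a claim about the
Yang–Mills mass gap

`[Balaban1985BackgroundPropagators]` ("[4]") Theorem 3.2 (3.48) p. 398, (3.25) p. 394; `[Balaban1985RegularSpaces]` (1.91) p. 91, p. 98 (the printed weights);
`[Balaban1984PropagatorsII]` Prop. 2.3 (2.87) p. 238, Lemma 2.1 (2.61) p. 234.

CITATION HEADER (lean-in-tree rule).  Cell `pub-ymgap` (YM Track A, HUMAN RULING D-0062), DAG node N05 = [B8], seat `pub-ymgap-dag-n05-c` (g9; (R1′) programme, file F14).
Composition of F11 (`towerGram_coercive_of_normBound`: gap from a norm bound on `T`) and F12 (`flatMatrix_normBound`: the Schur norm bound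
`C_T = (4(d+1) + a_max)η⁻²`): the `ℓ²` gap of `M = QT⁻²Qᵀ` with NO hypothesis beyond the consumer's shapes and the weight window, and its reading at the printed
weights `wPrinted` (`a_max = 8`, F4e `wPrinted_facts` ∕ `awPrinted_facts`).  Input of the Combes–Thomas step on the wall towers in the 𝒢-bound programme
(`B8Thm32GBoundCubeMember.GBoundCubeMemberPrinted`; design `HOME/pub-ymgap-dag-n05-c/R23-DESIGN.md`).

WHAT THIS FILE PROVES (kernel-checked; three theorems).
* ★ `towerGram_gap` — any `L ≥ 1`, any nonnegative weights with normalised size `≤ a_max`, cube datum `L ≤ ρ`, `n ≤ k`: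
  `Σ_p (L^{−(d+1)})^{j_p}·X_p² ≤ ((4(d+1) + a_max)η⁻²)²·(X ⬝ᵥ (QT⁻¹T⁻¹Qᵀ)X)`.
* ★ `towerGram_gap_printed` — the same at `w = wPrinted d ℓ η` (`L = ℓ + 1`, `η > 0`) with `a_max = 8`.
* §2 `towerGram_entry` — `(QT⁻¹T⁻¹Qᵀ)(p,p′) = ⟨T⁻¹(Qᵀe_p), T⁻¹(Qᵀe_{p′})⟩` (the form compared with p21's `W(u)W(v)X(u,v) = ⟨G′χ_u, G′χ_v⟩` in the tower parametrix).

HONEST SCOPE ∕ NOT CLAIMED.  An `ℓ²` gap only (no decay, no sup-norm statement); the 𝒢-bound stays OPEN.  Count-neutral; N05 NOT discharged; one finite `T⁴` programme at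
fixed `ε`, Bałaban as printed; nothing continuum ∕ ℝ⁴ ∕ OS ∕ mass-gap ∕ Clay.  No `sorry`, no `def`, no `instance`, no `notation`.  Unit `pub-ymgap-dag-n05-c` (g9), 2026-08-27.

RELATED IN THE TREE, NOT DUPLICATED (USED by name): `B8Eq348CubeMemberTowerGramCoercive.towerGram_coercive_of_normBound` (F11), `B8Eq348CubeMemberFlatMatrixNorm.
flatMatrix_normBound` (F12), `B8Eq1101CubeMemberWeights.{wPrinted, wPrinted_facts, awPrinted_facts}` (F4e); siblings `B8Eq191FlatTowerGram.isUnit_towerGram` (n05-e,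
invertibility without a constant), `B8Eq191FlatDirichletCoercive.weighted_coercive_flatMatrix` (g8, lower bound on `⟨v, Tv⟩`).
-/

noncomputable section

namespace Literature.MathematicalPhysics.QuantumFieldTheory.Balaban1983to89.B8Eq348CubeMemberTowerGramGap

open scoped Matrix
open B7Prop1Explicit (e)
open B8Eq131CubesAdmissible (cubeFam)
open B8CubeMemberZd (cubeLamS)
open B8Eq1101CubeMemberWeights (awPrinted wPrinted awPrinted_facts wPrinted_facts)
open B8Eq348CubeMemberTowerGramCoercive (towerGram_coercive_of_normBound)
open B8Eq348CubeMemberFlatMatrixNorm (flatMatrix_normBound)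
open Literature.MathematicalPhysics.QuantumLattice (blockMap)

variable {d : ℕ}

open Classical in
/-- **THE `ℓ²` GAP OF THE TOWER GRAM MATRIX** `M = QT⁻¹T⁻¹Qᵀ` of the cube member: `Σ_p L^{−(d+1)j_p}X_p² ≤ ((4(d+1) + a_max)η⁻²)²·⟨X, MX⟩` (F11 with F12's norm bound).
[cite: Balaban1985BackgroundPropagators, (3.48) p.398, (3.25) p.394; Balaban1984PropagatorsII, (2.87) p.238] -/
theorem towerGram_gap (hd : 0 < d + 1) {L : ℕ} (hL : 1 ≤ L) (a : Fin (d + 1) → ℤ) (M : ℕ) {ρ : ℕ} (hρ : L ≤ ρ) {k n : ℕ} (hn : n ≤ k)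
    {η : ℝ} (hη : η ≠ 0) (w : ℕ → ℝ) (hw0 : ∀ j, 0 ≤ w j) {amax : ℝ} (hamax0 : 0 ≤ amax)
    (hamax : ∀ j, j ≤ n → w j * η ^ 2 * ((L : ℝ) ^ j) ^ 2 * ((((L : ℝ) ^ (d + 1)) ^ j))⁻¹ ≤ amax)
    (S : Finset (Fin (d + 1) → ℤ)) (hS : ∀ x, x ∈ S ↔ x ∈ cubeFam false L a M ρ k 0)
    (B : Finset (ℕ × (Fin (d + 1) → ℤ))) (hB : ∀ p, p ∈ B ↔ p.1 ≤ n ∧ p.2 ∈ cubeLamS L a M ρ k n p.1)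
    (K : (Fin (d + 1) → ℤ) → (Fin (d + 1) → ℤ) → ℝ)
    (hK : ∀ x z, K x z = ((η ^ 2)⁻¹ * ∑ μ : Fin (d + 1), ((2 : ℝ) * (if z = x then (1 : ℝ) else 0) - (if z = x + e μ then (1 : ℝ) else 0)
        - (if z = x - e μ then (1 : ℝ) else 0))) +
        (∑ j ∈ Finset.range (n + 1), (if blockMap (L ^ j) x ∈ cubeLamS L a M ρ k n j ∧ blockMap (L ^ j) z = blockMap (L ^ j) x then
          w j * ((((L : ℝ) ^ (d + 1))⁻¹) ^ j) ^ 2 else 0)))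
    (T : Matrix ↥S ↥S ℝ) (hT : T = Matrix.of (fun x z : ↥S => K x.1 z.1))
    (Q : Matrix ↥B ↥S ℝ) (hQ : Q = Matrix.of (fun (p : ↥B) (z : ↥S) =>
      if blockMap (L ^ p.1.1) z.1 = p.1.2 then (((L : ℝ) ^ (d + 1))⁻¹) ^ p.1.1 else 0)) (X : ↥B → ℝ) :
    ∑ p : ↥B, (((L : ℝ) ^ (d + 1))⁻¹) ^ p.1.1 * (X p) ^ 2
      ≤ ((4 * ((d : ℝ) + 1) + amax) * (η ^ 2)⁻¹) ^ 2 * (X ⬝ᵥ ((Q * T⁻¹ * T⁻¹ * Qᵀ) *ᵥ X)) :=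
  towerGram_coercive_of_normBound hd hL a M hρ hn hη w hw0 S hS B hB K hK T hT Q hQ
    (fun v => flatMatrix_normBound hL a M hρ hn hη w hw0 hamax0 hamax S hS K hK T hT v) X

open Classical in
/-- **THE GAP AT THE PRINTED WEIGHTS** (`w = wPrinted d ℓ η`, `L = ℓ + 1`, `η > 0`; normalised size `a′_j ≤ 8`):
`Σ_p L^{−(d+1)j_p}X_p² ≤ ((4(d+1) + 8)η⁻²)²·⟨X, (QT⁻¹T⁻¹Qᵀ)X⟩`. [cite: Balaban1985BackgroundPropagators, (3.48) p.398; Balaban1985RegularSpaces, p.98] -/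
theorem towerGram_gap_printed {ℓ : ℕ} (hℓ : 1 ≤ ℓ) (a : Fin (d + 1) → ℤ) (M : ℕ) {ρ : ℕ} (hρ : ℓ + 1 ≤ ρ) {k n : ℕ} (hn : n ≤ k)
    {η : ℝ} (hη : 0 < η)
    (S : Finset (Fin (d + 1) → ℤ)) (hS : ∀ x, x ∈ S ↔ x ∈ cubeFam false (ℓ + 1) a M ρ k 0)
    (B : Finset (ℕ × (Fin (d + 1) → ℤ))) (hB : ∀ p, p ∈ B ↔ p.1 ≤ n ∧ p.2 ∈ cubeLamS (ℓ + 1) a M ρ k n p.1)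
    (K : (Fin (d + 1) → ℤ) → (Fin (d + 1) → ℤ) → ℝ)
    (hK : ∀ x z, K x z = ((η ^ 2)⁻¹ * ∑ μ : Fin (d + 1), ((2 : ℝ) * (if z = x then (1 : ℝ) else 0) - (if z = x + e μ then (1 : ℝ) else 0)
        - (if z = x - e μ then (1 : ℝ) else 0))) +
        (∑ j ∈ Finset.range (n + 1), (if blockMap ((ℓ + 1) ^ j) x ∈ cubeLamS (ℓ + 1) a M ρ k n j ∧
            blockMap ((ℓ + 1) ^ j) z = blockMap ((ℓ + 1) ^ j) x then
          wPrinted d ℓ η j * (((((ℓ + 1 : ℕ) : ℝ) ^ (d + 1))⁻¹) ^ j) ^ 2 else 0)))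
    (T : Matrix ↥S ↥S ℝ) (hT : T = Matrix.of (fun x z : ↥S => K x.1 z.1))
    (Q : Matrix ↥B ↥S ℝ) (hQ : Q = Matrix.of (fun (p : ↥B) (z : ↥S) =>
      if blockMap ((ℓ + 1) ^ p.1.1) z.1 = p.1.2 then (((((ℓ + 1 : ℕ) : ℝ)) ^ (d + 1))⁻¹) ^ p.1.1 else 0)) (X : ↥B → ℝ) :
    ∑ p : ↥B, (((((ℓ + 1 : ℕ) : ℝ)) ^ (d + 1))⁻¹) ^ p.1.1 * (X p) ^ 2
      ≤ ((4 * ((d : ℝ) + 1) + 8) * (η ^ 2)⁻¹) ^ 2 * (X ⬝ᵥ ((Q * T⁻¹ * T⁻¹ * Qᵀ) *ᵥ X)) := by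
  obtain ⟨hwin, -, -, -⟩ := awPrinted_facts hℓ
  obtain ⟨hwpos, -, hwwin⟩ := wPrinted_facts d hℓ hη
  have hamax : ∀ j, j ≤ n → wPrinted d ℓ η j * η ^ 2 * ((((ℓ + 1 : ℕ) : ℝ)) ^ j) ^ 2 * (((((ℓ + 1 : ℕ) : ℝ)) ^ (d + 1)) ^ j)⁻¹ ≤ 8 := by
    intro j _
    rw [hwwin j]
    rcases Nat.eq_zero_or_pos j with h0 | hp
    · subst h0; norm_num [awPrinted]
    · exact (hwin j hp).2
  exact towerGram_gap (Nat.succ_pos d) (Nat.succ_pos ℓ) a M hρ hn hη.ne' (wPrinted d ℓ η) (fun j => (hwpos j).le) (by norm_num) hamax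
    S hS B hB K hK T hT Q hQ X

/-! ## §2 The entries of the tower Gram matrix as inner products of `T⁻¹`-potentials of tower indicators (for the parametrix of the 𝒢-bound programme) -/

open B8Eq191FlatDirichletForm (isUnit_flatMatrix)
open B8Eq191FlatTowerGram (flatMatrix_inv_transpose)

open Classical in
/-- **`M(p,p′) = ⟨T⁻¹q_p, T⁻¹q_{p′}⟩`** with `q_p = Qᵀe_p = L^{−(d+1)j_p}·𝟙_{block p}`: the entries of `QT⁻¹T⁻¹Qᵀ` are the `ℓ²(□₀)` inner products of the
`T⁻¹`-potentials of the (normalised) tower indicators (`T⁻¹` symmetric).  This is the form in which the deep local model `η⁴·⟨G′χ_u, G′χ_v⟩` of p21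
(`B6Ineq281MultiLevelBox.Xk_symm`, `W(u)W(v)X(u,v) = ⟨G′χ_u, G′χ_v⟩`) is compared with `M` in the tower parametrix.
[cite: Balaban1985BackgroundPropagators, (3.48) p.398, (3.25) p.394; Balaban1984PropagatorsII, (2.69) p.235, (2.72) p.236] -/
theorem towerGram_entry {L : ℕ} {a : Fin (d + 1) → ℤ} {M ρ k n : ℕ} {η : ℝ} (w : ℕ → ℝ)
    (S : Finset (Fin (d + 1) → ℤ)) (B : Finset (ℕ × (Fin (d + 1) → ℤ)))
    (K : (Fin (d + 1) → ℤ) → (Fin (d + 1) → ℤ) → ℝ)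
    (hK : ∀ x z, K x z = ((η ^ 2)⁻¹ * ∑ μ : Fin (d + 1), ((2 : ℝ) * (if z = x then (1 : ℝ) else 0) - (if z = x + e μ then (1 : ℝ) else 0)
        - (if z = x - e μ then (1 : ℝ) else 0))) +
        (∑ j ∈ Finset.range (n + 1), (if blockMap (L ^ j) x ∈ cubeLamS L a M ρ k n j ∧ blockMap (L ^ j) z = blockMap (L ^ j) x then
          w j * ((((L : ℝ) ^ (d + 1))⁻¹) ^ j) ^ 2 else 0)))
    (T : Matrix ↥S ↥S ℝ) (hT : T = Matrix.of (fun x z : ↥S => K x.1 z.1)) (Q : Matrix ↥B ↥S ℝ) (p p' : ↥B) :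
    (Q * T⁻¹ * T⁻¹ * Qᵀ) p p' = (T⁻¹ *ᵥ (fun z => Qᵀ z p)) ⬝ᵥ (T⁻¹ *ᵥ (fun z => Qᵀ z p')) := by
  have hsymm : (T⁻¹)ᵀ = T⁻¹ := by rw [hT]; exact flatMatrix_inv_transpose L n (cubeLamS L a M ρ k n) w K hK S
  have hM : Q * T⁻¹ * T⁻¹ * Qᵀ = (T⁻¹ * Qᵀ)ᵀ * (T⁻¹ * Qᵀ) := by
    rw [Matrix.transpose_mul, Matrix.transpose_transpose, hsymm]
    simp only [Matrix.mul_assoc]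
  rw [hM, Matrix.mul_apply, dotProduct]
  refine Finset.sum_congr rfl fun x _ => ?_
  rw [Matrix.transpose_apply, Matrix.mul_apply, Matrix.mul_apply]
  rfl

end Literature.MathematicalPhysics.QuantumFieldTheory.Balaban1983to89.B8Eq348CubeMemberTowerGramGap
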